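import Summits.Ventures.PercRepro.Night2LocalThmEFinal

/-!
# PercRepro — the local form when every member is a layer-0 member; Theorem E at `k ≥ q` (night-2, gen 9)

The three-layer rule of `Night2LocalRuleDefs` / `Night2LocalRuleRows` certifies the local form (LI_G) at a
rank-`(q+1)` flat `G` with `|E ∖ G| ≤ q` whenever its layer-2 load stays below the residual capacity
(`localShadowHall_of_distance_two`).  When EVERY member below `G` is a layer-0 member (`|G ∖ cl B| = 1`)
the layer-2 weights vanish and the certificate is free: `localShadowHall_of_all_lay0`.

The coloop case: if `M|G` has at least `q` coloops then every member below `G` is a layer-0 member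
(`card_sdiff_clF_eq_one_of_kColoops`): a member whose closure `F` misses two elements of `G` has `F ⊇ K`
(a hyperplane of `M|G` missing a coloop `y` is `G ∖ y`), so `F = cl K` with `K` independent of size `q`;
the rest `X = G ∖ K` of `G` has rank one, so either `X ⊆ F` (then `F = G`) or `F ∩ X` has rank zero and
`B ⊇ K`, whence `E ∖ B ⊆ X ∪ (E ∖ G)` has rank `≤ 1 + q < q + 2`.  Hence **Theorem E at `k = q`** (and at
`k = q + 1`): `localShadowHall_dq_of_kColoops`, the case `(q + 1 − k)² < 2k`, `k = q` of NIGHT-2-local.md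
§17 Corollary E′(i) — so at `d = q` the local form holds for EVERY coloop count when `q ≤ 3`
(`localShadowHall_dq_of_q_le_three`), closing the type `(3, 1)` of the `q = 3` case split in the kernel.
-/

namespace PercRepro.Shadow

open Finset PerFlat ThmH

variable {α : Type*} [DecidableEq α] {M : Matroid α} [M.Finite]

/-! ## The certificate when every member is a layer-0 member -/

open scoped Classical in
/-- If every member below `G` is a layer-0 member, the layer-2 load vanishes. -/
theorem load2_eq_zero_of_all_lay0 {q : ℕ} {G : Finset α}
    (h0 : ∀ B ∈ membersIn M (Uq M (q + 2) q) G, B ∈ lay0 M q G) (S : Finset α) :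
    load2 M q G S = 0 := by
  unfold load2
  apply Finset.sum_eq_zero
  intro B hB
  unfold w2
  rw [if_neg]
  intro h
  exact h.1 (h0 B hB)

open scoped Classical in
/-- **The local form when every member is a layer-0 member** (`|E ∖ G| ≤ q`): the three-layer rule has no
layer-2 weight, so `localShadowHall_of_distance_two` applies with `load2 = 0 ≤ cap2`. -/
theorem localShadowHall_of_all_lay0 {q : ℕ} {G : Finset α} (hG : G ∈ flatsQ M (q + 1))
    (hd : (gr M \ G).card ≤ q)
    (h0 : ∀ B ∈ membersIn M (Uq M (q + 2) q) G, (G \ clF M B).card = 1) :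
    LocalShadowHall M q G := by
  have h0' : ∀ B ∈ membersIn M (Uq M (q + 2) q) G, B ∈ lay0 M q G := by
    intro B hB
    rw [mem_lay0]
    exact ⟨hB, h0 B hB, by omega⟩
  apply localShadowHall_of_distance_two hG hd
  intro S _
  rw [load2_eq_zero_of_all_lay0 h0' S]
  exact cap2_nonneg (capS_nonneg' hG hd S)

/-! ## Many coloops force every member into layer 0 -/

open scoped Classical in
/-- The coloops of `M|G` (the set counted by `kColoops`) form an independent set; its rank is its size. -/
theorem eRk_coloops_of_restrict {G : Finset α} (hG : G ⊆ gr M) :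
    M.eRk (((G.filter (fun y => y ∉ clF M (G.erase y))) : Finset α) : Set α) = (((G.filter (fun y => y ∉ clF M (G.erase y)))).card : ℕ∞) := by
  have h := eRk_union_coloops (M := M) hG ((G.filter (fun y => y ∉ clF M (G.erase y)))) (fun y hy => Finset.mem_filter.1 hy)
    (X := ∅) (Finset.empty_subset _) (Finset.disjoint_empty_right _)
  simpa using h

open scoped Classical in
/-- The rank of `G` is the number of coloops plus the rank of the rest. -/
theorem eRk_eq_kColoops_add {G : Finset α} (hG : G ⊆ gr M) :
    M.eRk (G : Set α) = (((G.filter (fun y => y ∉ clF M (G.erase y)))).card : ℕ∞) + M.eRk ((G \ (G.filter (fun y => y ∉ clF M (G.erase y))) : Finset α) : Set α) := by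
  have h := eRk_union_coloops (M := M) hG ((G.filter (fun y => y ∉ clF M (G.erase y)))) (fun y hy => Finset.mem_filter.1 hy)
    (X := G \ (G.filter (fun y => y ∉ clF M (G.erase y)))) Finset.sdiff_subset Finset.disjoint_sdiff
  have hKG : (G.filter (fun y => y ∉ clF M (G.erase y))) ⊆ G := Finset.filter_subset _ _
  rw [Finset.union_sdiff_of_subset hKG] at h
  exact h

open scoped Classical in
/-- A hyperplane of `M|G` missing a coloop `y` of `M|G` is `G ∖ {y}`: a member whose closure misses two
elements of `G` has every coloop of `M|G` in its closure. -/
theorem coloops_subset_clF_of_two_le {q : ℕ} {G : Finset α} (hG : G ∈ flatsQ M (q + 1)) {B : Finset α}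
    (hB : B ∈ membersIn M (Uq M (q + 2) q) G) (h2 : 2 ≤ (G \ clF M B).card) :
    (G.filter (fun y => y ∉ clF M (G.erase y))) ⊆ clF M B := by
  rw [mem_flatsQ] at hG
  obtain ⟨hGg, hGflat, hGr⟩ := hG
  rw [mem_membersIn] at hB
  obtain ⟨hBU, hBG⟩ := hB
  have hFr : M.eRk ((clF M B : Finset α) : Set α) = (q : ℕ∞) := by
    rw [coe_clF, M.eRk_closure_eq, (mem_Uq.1 hBU).2.1]
  intro y hy
  rw [Finset.mem_filter] at hy
  by_contra hyF
  -- `cl B ⊆ G ∖ y`, a set of rank `q`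
  have hsub : clF M B ⊆ G.erase y := by
    intro e he
    rw [Finset.mem_erase]
    exact ⟨fun h => hyF (h ▸ he), hBG he⟩
  have hGe : M.eRk ((G.erase y : Finset α) : Set α) = (q : ℕ∞) := by
    have h1 := eRk_insert_of_notMem_clF_erase hGg hy.1 hy.2 (X := G.erase y) le_rfl
    rw [Finset.insert_erase hy.1, hGr] at h1
    have h2 : (q : ℕ∞) + 1 = M.eRk ((G.erase y : Finset α) : Set α) + 1 := by
      rw [← h1]; push_cast; rfl
    exact (WithTop.add_right_cancel ENat.one_ne_top h2).symm
  -- so `cl B` and `G ∖ y` have the same closure, and `G ∖ y ⊆ cl B`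
  have hGeF : G.erase y ⊆ clF M (clF M B) := by
    have h := (M.isRkFinite_of_finite (clF M B).finite_toSet).closure_eq_closure_of_subset_of_eRk_ge_eRk
      (by exact_mod_cast hsub : ((clF M B : Finset α) : Set α) ⊆ ((G.erase y : Finset α) : Set α))
      (by rw [hGe, hFr])
    rw [← Finset.coe_subset, coe_clF, h]
    exact M.subset_closure _ (by rw [← coe_gr]; exact_mod_cast (Finset.erase_subset _ _).trans hGg)
  have hidem : clF M (clF M B) = clF M B := by
    rw [← Finset.coe_inj, coe_clF, coe_clF, Matroid.closure_closure]
  rw [hidem] at hGeF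
  -- hence `cl B = G ∖ y`, which misses a single element of `G`
  have hF : clF M B = G.erase y := le_antisymm hsub hGeF
  have : (G \ clF M B).card = 1 := by
    rw [hF, Finset.sdiff_erase_self]
    · exact Finset.card_singleton y
    · exact hy.1
  omega

open scoped Classical in
/-- **Many coloops force layer 0.**  If `M|G` has at least `q` coloops (`|E ∖ G| ≤ q`), every member below
the rank-`(q+1)` flat `G` has `|G ∖ cl B| = 1`. -/
theorem card_sdiff_clF_eq_one_of_kColoops {q : ℕ} {G : Finset α} (hG : G ∈ flatsQ M (q + 1))
    (hd : (gr M \ G).card ≤ q) (hk : q ≤ kColoops M G) {B : Finset α}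
    (hB : B ∈ membersIn M (Uq M (q + 2) q) G) : (G \ clF M B).card = 1 := by
  have hG' := hG
  rw [mem_flatsQ] at hG'
  obtain ⟨hGg, hGflat, hGr⟩ := hG'
  have hB' := hB
  rw [mem_membersIn] at hB'
  obtain ⟨hBU, hBG⟩ := hB'
  have hBU' := hBU
  rw [mem_Uq] at hBU'
  obtain ⟨hBg, hBq, hBc⟩ := hBU'
  set F := clF M B with hFdef
  have hFr : M.eRk (F : Set α) = (q : ℕ∞) := by
    rw [hFdef, coe_clF, M.eRk_closure_eq, hBq]
  have hFflat : M.IsFlat (F : Set α) := by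
    rw [hFdef, coe_clF]; exact M.isFlat_closure _
  have hFg : F ⊆ gr M := hBG.trans hGg
  -- `F ≠ G`, so `G ∖ F` is nonempty
  have hne : 1 ≤ (G \ F).card := by
    rw [Nat.one_le_iff_ne_zero, Ne, Finset.card_eq_zero, Finset.sdiff_eq_empty_iff_subset]
    intro hGF
    have : F = G := le_antisymm hBG hGF
    rw [this, hGr] at hFr
    have : q + 1 = q := by exact_mod_cast hFr
    omega
  by_contra hnot
  have h2 : 2 ≤ (G \ F).card := by omega
  set K := (G.filter (fun y => y ∉ clF M (G.erase y))) with hKdef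
  have hKF : K ⊆ F := coloops_subset_clF_of_two_le hG hB h2
  have hKG : K ⊆ G := Finset.filter_subset _ _
  have hKr : M.eRk (K : Set α) = (K.card : ℕ∞) := eRk_coloops_of_restrict hGg
  -- `#K ≤ q`, hence `#K = q`
  have hKle : K.card ≤ q := by
    have h := M.eRk_mono (by exact_mod_cast hKF : (K : Set α) ⊆ (F : Set α))
    rw [hKr, hFr] at h
    exact_mod_cast h
  have hKq : K.card = q := le_antisymm hKle hk
  -- the rest `X = G ∖ K` has rank one
  set X := G \ K with hXdef
  have hXr : M.eRk (X : Set α) = 1 := by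
    have h := eRk_eq_kColoops_add (M := M) hGg
    rw [hGr, ← hKdef, ← hXdef, hKq] at h
    have h' : (q : ℕ∞) + 1 = (q : ℕ∞) + M.eRk (X : Set α) := by rw [← h]; push_cast; rfl
    exact (WithTop.add_left_cancel (ENat.coe_ne_top q) h').symm
  have hXg : X ⊆ gr M := Finset.sdiff_subset.trans hGg
  -- `F ∩ X` has rank `0` or `1`
  have hYle : M.eRk ((F ∩ X : Finset α) : Set α) ≤ 1 := by
    rw [← hXr]
    exact M.eRk_mono (by exact_mod_cast Finset.inter_subset_right)
  rcases Order.le_one_iff.1 hYle with hY0 | hY1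
  · -- rank zero: `B ⊇ K` and `E ∖ B ⊆ X ∪ (E ∖ G)` has rank `≤ 1 + q`
    have hBF : B ⊆ F := subset_clF hBU
    have hBK : K ⊆ B := by
      -- `ρ(B) ≤ ρ(B ∩ K) + ρ(B ∩ X) ≤ #(B ∩ K)`, so `#(B ∩ K) ≥ q = #K`
      have hsplit : B = (B ∩ K) ∪ (B ∩ (F ∩ X)) := by
        ext e
        simp only [Finset.mem_union, Finset.mem_inter]
        constructor
        · intro he
          by_cases heK : e ∈ K
          · exact Or.inl ⟨he, heK⟩
          · exact Or.inr ⟨he, hBF he, Finset.mem_sdiff.2 ⟨hBG (hBF he), heK⟩⟩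
        · rintro (he | he)
          · exact he.1
          · exact he.1
      have hr1 : M.eRk (B : Set α) ≤ M.eRk ((B ∩ K : Finset α) : Set α) +
          M.eRk ((B ∩ (F ∩ X) : Finset α) : Set α) := by
        conv_lhs => rw [hsplit]
        push_cast
        exact M.eRk_union_le_eRk_add_eRk _ _
      have hr2 : M.eRk ((B ∩ (F ∩ X) : Finset α) : Set α) = 0 := by
        apply le_antisymm ?_ zero_le
        rw [← hY0]
        exact M.eRk_mono (by exact_mod_cast Finset.inter_subset_right)
      have hr3 : M.eRk ((B ∩ K : Finset α) : Set α) ≤ ((B ∩ K).card : ℕ∞) := by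
        have := M.eRk_le_encard ((B ∩ K : Finset α) : Set α)
        rwa [Set.encard_coe_eq_coe_finsetCard] at this
      rw [hr2, add_zero, hBq] at hr1
      have hcard : q ≤ (B ∩ K).card := by exact_mod_cast hr1.trans hr3
      have hle : (B ∩ K).card ≤ K.card := Finset.card_le_card Finset.inter_subset_right
      have heq : (B ∩ K).card = K.card := by omega
      have := Finset.eq_of_subset_of_card_le Finset.inter_subset_right heq.ge
      rw [← this]
      exact Finset.inter_subset_left
    -- `E ∖ B ⊆ X ∪ (E ∖ G)`
    have hcompl : gr M \ B ⊆ X ∪ (gr M \ G) := by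
      intro e he
      rw [Finset.mem_sdiff] at he
      rw [Finset.mem_union, Finset.mem_sdiff, Finset.mem_sdiff]
      by_cases heG : e ∈ G
      · exact Or.inl ⟨heG, fun heK => he.2 (hBK heK)⟩
      · exact Or.inr ⟨he.1, heG⟩
    have hr : M.eRk ((gr M \ B : Finset α) : Set α) ≤ 1 + (q : ℕ∞) := by
      calc M.eRk ((gr M \ B : Finset α) : Set α)
          ≤ M.eRk ((X ∪ (gr M \ G) : Finset α) : Set α) := M.eRk_mono (by exact_mod_cast hcompl)
        _ ≤ M.eRk (X : Set α) + M.eRk ((gr M \ G : Finset α) : Set α) := by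
            push_cast; exact M.eRk_union_le_eRk_add_eRk _ _
        _ ≤ 1 + (q : ℕ∞) := by
            rw [hXr]
            gcongr
            have := M.eRk_le_encard ((gr M \ G : Finset α) : Set α)
            rw [Set.encard_coe_eq_coe_finsetCard] at this
            exact this.trans (by exact_mod_cast hd)
    rw [hBc] at hr
    have : q + 2 ≤ 1 + q := by exact_mod_cast hr
    omega
  · -- rank one: `X ⊆ cl X = cl (F ∩ X) ⊆ F`, so `G ⊆ F`, contradicting `G ∖ F ≠ ∅`
    have hXF : X ⊆ F := by
      have h := (M.isRkFinite_of_finite (F ∩ X).finite_toSet).closure_eq_closure_of_subset_of_eRk_ge_eRk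
        (by exact_mod_cast Finset.inter_subset_right : ((F ∩ X : Finset α) : Set α) ⊆ (X : Set α))
        (by rw [hXr, hY1])
      have hclF : M.closure ((F ∩ X : Finset α) : Set α) ⊆ (F : Set α) := by
        have := M.closure_subset_closure (by exact_mod_cast Finset.inter_subset_left :
          ((F ∩ X : Finset α) : Set α) ⊆ (F : Set α))
        rwa [hFflat.closure] at this
      rw [← Finset.coe_subset]
      calc (X : Set α) ⊆ M.closure (X : Set α) :=
            M.subset_closure _ (by rw [← coe_gr]; exact_mod_cast hXg)
        _ = M.closure ((F ∩ X : Finset α) : Set α) := h.symm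
        _ ⊆ (F : Set α) := hclF
    have hGF : G ⊆ F := by
      intro e he
      by_cases heK : e ∈ K
      · exact hKF heK
      · exact hXF (Finset.mem_sdiff.2 ⟨he, heK⟩)
    have : (G \ F).card = 0 := by
      rw [Finset.card_eq_zero, Finset.sdiff_eq_empty_iff_subset]; exact hGF
    omega

/-! ## Theorem E at `k ≥ q`, and the whole regime `d = q` for `q ≤ 3` -/

open scoped Classical in
/-- **The local form at a fat flat with at least `q` coloops** (`|E ∖ G| ≤ q`): every member is a layer-0
member, served by its unique covering set (Lemma A bounds the load by `|E ∖ G|·Φ/(1 + |E ∖ G|) < 1`). -/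
theorem localShadowHall_of_kColoops {q : ℕ} {G : Finset α} (hG : G ∈ flatsQ M (q + 1))
    (hd : (gr M \ G).card ≤ q) (hk : q ≤ kColoops M G) : LocalShadowHall M q G :=
  localShadowHall_of_all_lay0 hG hd (fun _ hB => card_sdiff_clF_eq_one_of_kColoops hG hd hk hB)

open scoped Classical in
/-- **Theorem E, both halves**: at `|E ∖ G| = q` the local form holds when `2k ≤ (q + 1 − k)²`
(`localShadowHall_dq`) or when `k ≥ q` (`localShadowHall_of_kColoops`), `k` the number of coloops of `M|G`. -/
theorem localShadowHall_dq' {q : ℕ} {G : Finset α} (hG : G ∈ flatsQ M (q + 1))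
    (hd : (gr M \ G).card = q) (hk : 2 * kColoops M G ≤ (q + 1 - kColoops M G) ^ 2 ∨ q ≤ kColoops M G) :
    LocalShadowHall M q G := by
  rcases hk with hk | hk
  · exact localShadowHall_dq hG hd hk
  · exact localShadowHall_of_kColoops hG hd.le hk

open scoped Classical in
/-- **The regime `|E ∖ G| = q` is closed for `q ≤ 3`**: every coloop count `k` satisfies `2k ≤ (q + 1 − k)²`
or `k ≥ q` (`k = 0, 1, 2` resp. `k ≥ 3` at `q = 3`).  At `q = 3` this is the type `(3, 1)` of the case split
of NIGHT-2-local.md §16 in the kernel. -/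
theorem localShadowHall_dq_of_q_le_three {q : ℕ} (hq : q ≤ 3) {G : Finset α} (hG : G ∈ flatsQ M (q + 1))
    (hd : (gr M \ G).card = q) : LocalShadowHall M q G := by
  apply localShadowHall_dq' hG hd
  by_cases hk : q ≤ kColoops M G
  · exact Or.inr hk
  · left
    push Not at hk
    set k := kColoops M G with hkdef
    interval_cases q <;> interval_cases k <;> norm_num

end PercRepro.Shadow
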